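import Summits.BirchSwinnertonDyer.BirchSwinnertonDyer.Theorems.SignedLowerHalvesSmallImageLowerHalfBothSignsRttCharRoadE1LocalCoresBridge
import HarnessLib

/-!
# Route `SignedLowerHalves`, crux L `SmallImageLowerHalfBothSigns` (stmt-BirchSwinnertonDyer-23599), line `rtt_w3` v11 — brick D3-W AT `p`, CLASS-LEVEL
# FORM for the glue (memo `Lines/rtt_w3-MEMO-D3c-w3g17.md` §8–§9): the input is now a CLASS `x ∈ H¹(↥(Γ_{k_n} ∩ galRange K), E[p^∞])` lying in the
# Kummer condition cut out by the TRANSPORTED signed group `transportPoints (E^ε(K_n·K_w))` at the package's `ι` — which is what cell bsd-potss's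
# `EtaLayer.subgroupH1Iso_mem_localKummerOverOfEmb_iff` (QuadraticBranchSignedControlEtaLayerKummer) produces from the `K`-side signed Kummer condition —
# and the output is the signed Kummer condition at `ι` for `cor (e^* x)` over `Γ_{k_n}`.

Width seat `bsd-line-slh-p3-w3` g17 under LEAD `cruxlead-stmt-BirchSwinnertonDyer-23599` (cell `bsd-ssimc`; `--supports stmt-BirchSwinnertonDyer-23599 --as helper`).
THEOREMS ONLY (no definition, no named fact, no instance, no `sorry`). BSD / crux L / INJ are NOT proved here.

* `exists_pow_nsmul_apply_eq_zero` — a continuous map from a compact space to `E[p^∞]` (discrete, `p`-primary) is killed by ONE power of `p`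
  (finite range) — the hypothesis `ha` of p765485 / `…E1LocalCores` for free.
* `compactSpace_subgroup_of_isOpen` — an open subgroup of `Γ_k` is compact (closed in the compact `Γ_k`).
* ★★★★ `corH1_resH1Hom_mem_localKummerOverOfEmb_signed_of_mem` — `x ∈ localKummerOverOfEmb W p (κ.layerSubgroup n ⊓ galRange K) ι
  ((E^ε(K_n·E')).map transportPoints)` ⇒ `corH1 (resH1Hom e id x) ∈ localKummerOverOfEmb W p (κ.layerSubgroup n) ι (E^ε(k_n·E))`
  (unpack the witness `Q'`, `p^{k'}Q' = transportPoints P₁`; `Q' = transportPoints Q_K` by `EtaLayer.transportPoints_bijective`; Bridge ★★★).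

References: [SerreGaloisCohomology1997] I §2.4, II §1.1; [Kobayashi2003] Def. 1.1; [NeukirchSchmidtWingberg2008] I §5.
-/

set_option autoImplicit false
set_option linter.dupNamespace false -- D-0017: single-problem summit, the namespace repeats the problem name by design
noncomputable section

open scoped Classical

universe u

namespace Summit.BirchSwinnertonDyer.BirchSwinnertonDyer.Theorems.SmallImageCharSignedSelmer

open Literature.NumberTheory.EllipticCurves Literature.NumberTheory.GaloisRepresentations Field
  Summit.BirchSwinnertonDyer.Rank1Residual.Additive.LocalTransport

/-! ## §1 Uniform torsion exponent and compactness -/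

section Torsion

variable {k : Type u} [Field k] (W : WeierstrassCurve k) (p : ℕ)

/-- **One power of `p` kills a continuous map from a compact space to `E[p^∞]`**: the range is finite (`E[p^∞]` is discrete) and each value is killed
by some power of `p`. [folklore] -/
theorem exists_pow_nsmul_apply_eq_zero {X : Type u} [TopologicalSpace X] [CompactSpace X] (f : C(X, W.geomPrimaryTorsion p)) :
    ∃ a : ℕ, ∀ x : X, p ^ a • f x = 0 := by
  have hfin : (Set.range f).Finite := (isCompact_range f.continuous).finite_of_discrete
  have hk : ∀ t : W.geomPrimaryTorsion p, ∃ n : ℕ, p ^ n • t = 0 := fun t ↦ by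
    obtain ⟨n, hn⟩ := (AddCommGroup.mem_primaryComponent).1 t.2
    exact ⟨n, Subtype.ext (by rw [AddSubmonoidClass.coe_nsmul]; exact hn)⟩
  choose n hn using hk
  refine ⟨hfin.toFinset.sup n, fun x ↦ ?_⟩
  have hle : n (f x) ≤ hfin.toFinset.sup n := Finset.le_sup (by rw [Set.Finite.mem_toFinset]; exact ⟨x, rfl⟩)
  obtain ⟨d, hd⟩ := Nat.exists_eq_add_of_le hle
  rw [hd, add_comm, pow_add, mul_smul, hn, smul_zero]

/-- An open subgroup of the (compact) absolute Galois group is compact. [cite: SerreGaloisCohomology1997, I §1.1] -/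
theorem compactSpace_subgroup_of_isOpen [CompactSpace (absoluteGaloisGroup k)] (H : Subgroup (absoluteGaloisGroup k))
    (hH : IsOpen (H : Set (absoluteGaloisGroup k))) :
    CompactSpace H :=
  isCompact_iff_compactSpace.1 (H.isClosed_of_isOpen hH).isCompact

end Torsion

/-! ## §2 The class-level form at the layers -/

section Layers

variable {k : Type u} [Field k] [NumberField k] {p : ℕ} [hp : Fact p.Prime] (hp2 : p ≠ 2) (κ : ZpExtension k p)
  (K : Type u) [Field K] [NumberField K] [Algebra k K] (hK2 : Module.finrank k K = 2)
  {E : Type u} [Field E] [Algebra k E] {E' : Type u} [Field E'] [Algebra K E'] [Algebra E E'] [Algebra k E'] [IsScalarTower k K E']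
  (ι : AlgebraicClosure k →ₐ[k] AlgebraicClosure E) (ι₂ : AlgebraicClosure E ≃+* AlgebraicClosure E')
  (ι' : AlgebraicClosure K →ₐ[K] AlgebraicClosure E')
  (hcompat : ∀ z : AlgebraicClosure k, ι' (closureEmb (K := k) K z) = ι₂ (ι z))
  (hι₂ : ∀ a : E, ι₂ (algebraMap E (AlgebraicClosure E) a) = algebraMap E' (AlgebraicClosure E') (algebraMap E E' a))
  (hfixU : ∀ h : absoluteGaloisGroup E, resGalOfEmb ι h ∈ galRange (K := k) K → ∀ y : E',
    (show AlgebraicClosure E ≃ₐ[E] AlgebraicClosure E from h) (ι₂.symm (algebraMap E' (AlgebraicClosure E') y)) =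
      ι₂.symm (algebraMap E' (AlgebraicClosure E') y))
  (hU : (galRange (K := k) K).index = 2) (W : WeierstrassCurve k) (ε : ℤˣ) (n : ℕ)
  [((galRange (K := k) K).subgroupOf (κ.layerSubgroup n)).Normal]

include hι₂ hfixU in
/-- ★★★★ **D3-W at `p`, class-level form.** At layer `n` (`H = κ.layerSubgroup n`, `U = galRange K` of index `2`, `N = U.subgroupOf H`, an iso
`e : ↥N →ₜ* ↥(H ⊓ U)` over `Γ_k`, `c ∈ Λ_n` with `res_ι c ∉ U`; `H ⊓ U` open): if a class `x ∈ H¹(↥(H ⊓ U), E[p^∞])` lies in Kobayashi's Kummer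
condition at `ι` cut out by `transportPoints (E^ε(K_n·E'))` — the output of `EtaLayer.subgroupH1Iso_mem_localKummerOverOfEmb_iff` applied to a
`K`-side class in the signed Kummer condition `E^ε(K_n·E')` at `ι'` — then
`corH1 (resH1Hom e id x) ∈ localKummerOverOfEmb W p Γ_{k_n} ι (E^ε(k_n·E))`.
[cite: Kobayashi2003, Def. 1.1] [cite: SerreGaloisCohomology1997, I §2.4, II §1.1] [cite: NeukirchSchmidtWingberg2008, I §5] -/
theorem corH1_resH1Hom_mem_localKummerOverOfEmb_signed_of_mem
    (e : ((galRange (K := k) K).subgroupOf (κ.layerSubgroup n)) →ₜ* (κ.layerSubgroup n ⊓ galRange (K := k) K : Subgroup (absoluteGaloisGroup k)))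
    (he : ∀ x : (galRange (K := k) K).subgroupOf (κ.layerSubgroup n),
      ((e x : (κ.layerSubgroup n ⊓ galRange (K := k) K : Subgroup (absoluteGaloisGroup k))) : absoluteGaloisGroup k) =
        ((x : κ.layerSubgroup n) : absoluteGaloisGroup k))
    {c : absoluteGaloisGroup E} (hc : c ∈ localSubgroupOfEmb (κ.layerSubgroup n) ι) (hcU : resGalOfEmb ι c ∉ galRange (K := k) K)
    (hN : IsOpen (((galRange (K := k) K).subgroupOf (κ.layerSubgroup n) : Subgroup (κ.layerSubgroup n)) : Set (κ.layerSubgroup n)))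
    (hM : ∀ m : W.geomPrimaryTorsion p, Continuous fun g : κ.layerSubgroup n ↦ g • m)
    (hopen : IsOpen ((κ.layerSubgroup n ⊓ galRange (K := k) K : Subgroup (absoluteGaloisGroup k)) : Set (absoluteGaloisGroup k)))
    (x : W.subgroupH1 p (κ.layerSubgroup n ⊓ galRange (K := k) K))
    (hx : x ∈ Kobayashi2003.localKummerOverOfEmb W p (κ.layerSubgroup n ⊓ galRange (K := k) K) ι
      ((Kobayashi2003.signedLocalPointsOfEmb (κ.restrictOfFinrankEqTwo hp2 K hK2) ι' (W.baseChange K) ε n).map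
        (transportPoints K ι ι₂ ι' hcompat W))) :
    corH1 hN hM (xor_mem_subgroupOf_of_index_two (κ.layerSubgroup n) (galRange (K := k) K) ι hU hc hcU)
        (resH1Hom e (AddMonoidHom.id (W.geomPrimaryTorsion p)) (smul_eq_smul_of_coe_eq W p (κ.layerSubgroup n) (galRange (K := k) K) e he) x) ∈
      Kobayashi2003.localKummerOverOfEmb W p (κ.layerSubgroup n) ι (Kobayashi2003.signedLocalPointsOfEmb κ ι W ε n) := by
  obtain ⟨ξ₀, Q', k', rfl, hA, hτ⟩ := hx
  -- the witness is a transport: `Q' = transportPoints Q_K`, `p^{k'} Q_K ∈ E^ε(K_n·E')`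
  obtain ⟨P₁, hP₁, hP₁eq⟩ := AddSubgroup.mem_map.1 hA
  obtain ⟨Q_K, rfl⟩ := (EtaLayer.transportPoints_bijective K ι ι₂ ι' hcompat W).2 Q'
  have hQA : p ^ k' • Q_K ∈ Kobayashi2003.signedLocalPointsOfEmb (κ.restrictOfFinrankEqTwo hp2 K hK2) ι' (W.baseChange K) ε n := by
    have hinj := (EtaLayer.transportPoints_bijective K ι ι₂ ι' hcompat W).1
    rw [← map_nsmul] at hP₁eq
    rw [← hinj hP₁eq]
    exact hP₁
  -- a uniform torsion exponent for `ξ₀`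
  haveI : CompactSpace (κ.layerSubgroup n ⊓ galRange (K := k) K : Subgroup (absoluteGaloisGroup k)) :=
    compactSpace_subgroup_of_isOpen _ hopen
  obtain ⟨a, ha⟩ := exists_pow_nsmul_apply_eq_zero W p ξ₀.1
  exact corH1_resH1Hom_mem_localKummerOverOfEmb_signed hp2 κ K hK2 ι ι₂ ι' hcompat hι₂ hfixU hU W ε n e he hc hcU hN hM ξ₀ ha Q_K k' hQA hτ

end Layers

end Summit.BirchSwinnertonDyer.BirchSwinnertonDyer.Theorems.SmallImageCharSignedSelmer

end
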